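import Literature.MathematicalPhysics.StatisticalMechanics.BarlowStacking
import HarnessLib

/-!
# Co-axial walls: the in-plane bond classes carry the sine of the wall inclination

HONEST FRAMING. Part of the venture `Summits/Ventures/Crystal3D` (cell `crystal3d-full`), helper
`--supports` the crux `CoaxialWallLaw` (stmt-Ventures-19481, `route-Ventures-StickyWulffConstant`),
REGISTERED line `WallLedgerF` (planner cf-p1 gen 16), stub `stub_coaxialTwoSlabAdhesion`
(terrace/riser ledger).  Pure Euclidean algebra in `ℝ³`; nothing about packings.

THE RISER CURRENCY.  For a CO-AXIAL pair of fcc grains with shared Barlow frame `L` (axis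
`m = L e₃`), the three IN-PLANE bond classes `L u₁, L u₂, L (u₂ − u₁)` (`u₁ = (1,0,0)`,
`u₂ = (½, √3/2, 0)`: the triangular-layer directions of `BarlowStacking.lean`) are period vectors
of BOTH grains; a basal terrace (coherent twin plane / stacking fault) breaks none of their bond
lines, a riser breaks them.  Through a disc of radius `ρ` normal to the cell axis `e₃` pass
`√2 |⟪L uᵢ, e₃⟫| π ρ² + O(ρ)` lines of class `i` (covolume `1/√2`), so the number of in-plane bond
lines the wall must break is governed by `√2 Σᵢ |⟪L uᵢ, e₃⟫|`.  This file proves the conversion of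
that line density into the crux's sine term:

  `√6 · √(1 − ⟪L e₃, e₃⟫²) ≤ √2 · (|⟪L u₁, e₃⟫| + |⟪L u₂, e₃⟫| + |⟪L (u₂ − u₁), e₃⟫|) ≤ 2√2 · √(1 − ⟪L e₃, e₃⟫²)`

(`coaxial_sine_le_inPlaneClasses`, `inPlaneClasses_le_coaxial_sine`), i.e. with
`sin θ = √(1 − ⟪L e₃, e₃⟫²)` the in-plane line density lies in `[√6 sin θ, 2√2 sin θ]`
(hexagonal anisotropy of the triangular layer: minimum `√3` of `|a| + |a/2 + (√3/2) b| + |a/2 − (√3/2) b|`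
on the unit circle at the `⟨112⟩`-type azimuth, maximum `2` at the `⟨110⟩` azimuth).  With the
charged constant `c₁ = ½` of the crux, every broken in-plane line end therefore needs to carry
only `1/(2√6) = 0.204` units of deficiency (memo HOME/cf-p1/ROUTE.md §68; this seat's NOTES).

WHAT THIS IS NOT: no statement about packings or deficiencies; the stub and the crux are untouched;
rung F-C1 not moved.
-/

noncomputable section

namespace Summit.Ventures.Crystal3D.Theorems

open Literature.MathematicalPhysics.StatisticalMechanics (triangularVec₁ triangularVec₂)
open scoped InnerProductSpace

/-- The hexagonal norm dominates `√3` times the Euclidean norm: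
`√3 · √(a² + b²) ≤ |a| + |a/2 + (√3/2) b| + |a/2 − (√3/2) b|`. -/
theorem sqrt_three_mul_sqrt_le_hexNorm (a b : ℝ) :
    Real.sqrt 3 * Real.sqrt (a ^ 2 + b ^ 2) ≤
      |a| + |a / 2 + Real.sqrt 3 / 2 * b| + |a / 2 - Real.sqrt 3 / 2 * b| := by
  have h3 : Real.sqrt 3 ^ 2 = 3 := Real.sq_sqrt (by norm_num)
  have h3pos : 0 < Real.sqrt 3 := Real.sqrt_pos.2 (by norm_num)
  set S : ℝ := |a| + |a / 2 + Real.sqrt 3 / 2 * b| + |a / 2 - Real.sqrt 3 / 2 * b| with hS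
  have hSnn : 0 ≤ S := by positivity
  -- the two lower bounds `2|a| ≤ S` and `|a| + √3 |b| ≤ S`
  have h1 : 2 * |a| ≤ S := by
    have := abs_add_le (a / 2 + Real.sqrt 3 / 2 * b) (a / 2 - Real.sqrt 3 / 2 * b)
    have e : a / 2 + Real.sqrt 3 / 2 * b + (a / 2 - Real.sqrt 3 / 2 * b) = a := by ring
    rw [e] at this
    rw [hS]; linarith
  have h2 : |a| + Real.sqrt 3 * |b| ≤ S := by
    have := abs_sub (a / 2 + Real.sqrt 3 / 2 * b) (a / 2 - Real.sqrt 3 / 2 * b)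
    have e : a / 2 + Real.sqrt 3 / 2 * b - (a / 2 - Real.sqrt 3 / 2 * b) = Real.sqrt 3 * b := by ring
    rw [e, abs_mul, abs_of_pos h3pos] at this
    rw [hS]; linarith
  -- hence `3 (a² + b²) ≤ S²`
  have hsq : 3 * (a ^ 2 + b ^ 2) ≤ S ^ 2 := by
    have ha2 : |a| ^ 2 = a ^ 2 := sq_abs a
    have hb2 : |b| ^ 2 = b ^ 2 := sq_abs b
    rcases le_or_gt (|a|) (Real.sqrt 3 * |b|) with hle | hlt
    · have hk : |a| * |a| ≤ |a| * (Real.sqrt 3 * |b|) :=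
        mul_le_mul_of_nonneg_left hle (abs_nonneg a)
      have hp : 0 ≤ |a| + Real.sqrt 3 * |b| := by positivity
      have hq : (|a| + Real.sqrt 3 * |b|) ^ 2 ≤ S ^ 2 := pow_le_pow_left₀ hp h2 2
      nlinarith
    · have hk : Real.sqrt 3 * |b| * (Real.sqrt 3 * |b|) ≤ |a| * |a| := by
        have hnn : 0 ≤ Real.sqrt 3 * |b| := by positivity
        exact mul_le_mul hlt.le hlt.le hnn (abs_nonneg a)
      have hp : 0 ≤ 2 * |a| := by positivity
      have hq : (2 * |a|) ^ 2 ≤ S ^ 2 := pow_le_pow_left₀ hp h1 2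
      nlinarith
  -- take square roots
  have hl : Real.sqrt 3 * Real.sqrt (a ^ 2 + b ^ 2) = Real.sqrt (3 * (a ^ 2 + b ^ 2)) := by
    rw [Real.sqrt_mul (by norm_num)]
  rw [hl, show S = Real.sqrt (S ^ 2) by rw [Real.sqrt_sq hSnn]]
  exact Real.sqrt_le_sqrt hsq

/-- The hexagonal norm is at most `2` times the Euclidean norm:
`|a| + |a/2 + (√3/2) b| + |a/2 − (√3/2) b| ≤ 2 √(a² + b²)`. -/
theorem hexNorm_le_two_mul_sqrt (a b : ℝ) :
    |a| + |a / 2 + Real.sqrt 3 / 2 * b| + |a / 2 - Real.sqrt 3 / 2 * b| ≤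
      2 * Real.sqrt (a ^ 2 + b ^ 2) := by
  have h3 : Real.sqrt 3 ^ 2 = 3 := Real.sq_sqrt (by norm_num)
  have h3pos : 0 < Real.sqrt 3 := Real.sqrt_pos.2 (by norm_num)
  set x : ℝ := a / 2 with hx
  set y : ℝ := Real.sqrt 3 / 2 * b with hy
  -- `|x + y| + |x − y| = 2 max |x| |y|`
  have hmax : |x + y| + |x - y| ≤ 2 * max |x| |y| := by
    rcases le_total 0 (x + y) with h₁ | h₁ <;> rcases le_total 0 (x - y) with h₂ | h₂
    · rw [abs_of_nonneg h₁, abs_of_nonneg h₂]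
      have : x ≤ |x| := le_abs_self x
      have : |x| ≤ max |x| |y| := le_max_left _ _
      linarith
    · rw [abs_of_nonneg h₁, abs_of_nonpos h₂]
      have : y ≤ |y| := le_abs_self y
      have : |y| ≤ max |x| |y| := le_max_right _ _
      linarith
    · rw [abs_of_nonpos h₁, abs_of_nonneg h₂]
      have : -y ≤ |y| := neg_le_abs y
      have : |y| ≤ max |x| |y| := le_max_right _ _
      linarith
    · rw [abs_of_nonpos h₁, abs_of_nonpos h₂]
      have : -x ≤ |x| := neg_le_abs x
      have : |x| ≤ max |x| |y| := le_max_left _ _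
      linarith
  have hr : 0 ≤ Real.sqrt (a ^ 2 + b ^ 2) := Real.sqrt_nonneg _
  have hra : |a| ≤ Real.sqrt (a ^ 2 + b ^ 2) := by
    rw [← Real.sqrt_sq_eq_abs]; exact Real.sqrt_le_sqrt (by nlinarith)
  have hrb : |b| ≤ Real.sqrt (a ^ 2 + b ^ 2) := by
    rw [← Real.sqrt_sq_eq_abs]; exact Real.sqrt_le_sqrt (by nlinarith)
  have hxa : |x| = |a| / 2 := by rw [hx, abs_div]; norm_num
  have hyb : |y| = Real.sqrt 3 / 2 * |b| := by
    rw [hy, abs_mul, abs_of_pos (by positivity : (0 : ℝ) < Real.sqrt 3 / 2)]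
  have hs3 : Real.sqrt 3 ≤ 2 := by
    rw [show (2 : ℝ) = Real.sqrt 4 by rw [show (4 : ℝ) = 2 ^ 2 by norm_num, Real.sqrt_sq (by norm_num)]]
    exact Real.sqrt_le_sqrt (by norm_num)
  -- Cauchy–Schwarz for the `(1, √3)` direction: `|a| + √3 |b| ≤ 2 √(a² + b²)`
  have hcs : |a| + Real.sqrt 3 * |b| ≤ 2 * Real.sqrt (a ^ 2 + b ^ 2) := by
    have hp : 0 ≤ |a| + Real.sqrt 3 * |b| := by positivity
    have hsq : (|a| + Real.sqrt 3 * |b|) ^ 2 ≤ (2 * Real.sqrt (a ^ 2 + b ^ 2)) ^ 2 := by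
      have hr2 : Real.sqrt (a ^ 2 + b ^ 2) ^ 2 = a ^ 2 + b ^ 2 := Real.sq_sqrt (by positivity)
      rw [mul_pow, hr2]
      nlinarith [sq_nonneg (Real.sqrt 3 * |a| - |b|), sq_abs a, sq_abs b, abs_nonneg a, abs_nonneg b]
    exact (pow_le_pow_iff_left₀ hp (by positivity) two_ne_zero).1 hsq
  rcases le_total |x| |y| with hxy | hxy
  · rw [max_eq_right hxy] at hmax
    rw [hyb] at hmax
    linarith
  · rw [max_eq_left hxy] at hmax
    rw [hxa] at hmax
    linarith

/-- Coordinates of `triangularVec₁ 1 = (1, 0, 0)`. -/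
theorem triangularVec₁_one_apply :
    triangularVec₁ 1 0 = 1 ∧ triangularVec₁ 1 1 = 0 ∧ triangularVec₁ 1 2 = 0 := by
  simp [triangularVec₁]

/-- Coordinates of `triangularVec₂ 1 = (1/2, √3/2, 0)`. -/
theorem triangularVec₂_one_apply :
    triangularVec₂ 1 0 = 1 / 2 ∧ triangularVec₂ 1 1 = Real.sqrt 3 / 2 ∧ triangularVec₂ 1 2 = 0 := by
  simp [triangularVec₂]

/-- Inner products with the two layer generators in coordinates:
`⟪u₁, n⟫ = n 0`, `⟪u₂, n⟫ = n 0 / 2 + (√3/2) n 1`. -/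
theorem inner_triangularVec (n : EuclideanSpace ℝ (Fin 3)) :
    ⟪triangularVec₁ 1, n⟫_ℝ = n 0 ∧
      ⟪triangularVec₂ 1, n⟫_ℝ = n 0 / 2 + Real.sqrt 3 / 2 * n 1 := by
  constructor
  · rw [EuclideanSpace.inner_eq_star_dotProduct, star_trivial]
    simp [triangularVec₁, Fin.sum_univ_three, dotProduct]
  · rw [EuclideanSpace.inner_eq_star_dotProduct, star_trivial]
    simp [triangularVec₂, Fin.sum_univ_three, dotProduct]
    ring

/-- For a unit vector `n` of `ℝ³`: `1 − (n 2)² = (n 0)² + (n 1)²`. -/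
theorem one_sub_sq_apply_two (n : EuclideanSpace ℝ (Fin 3)) (hn : ‖n‖ = 1) :
    1 - n 2 ^ 2 = n 0 ^ 2 + n 1 ^ 2 := by
  have h : ‖n‖ ^ 2 = n 0 ^ 2 + n 1 ^ 2 + n 2 ^ 2 := by
    rw [EuclideanSpace.norm_sq_eq, Fin.sum_univ_three]
    simp only [Real.norm_eq_abs, sq_abs]
  rw [hn, one_pow] at h
  linarith

/-- **The sine of the wall inclination is carried by the in-plane classes (lower bound).**
For every linear isometry `L` of `ℝ³` (the shared Barlow frame of a co-axial pair; axis
`m = L e₃`), with `u₁ = (1,0,0)`, `u₂ = (½, √3/2, 0)` the triangular-layer generators: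
`√6 · √(1 − ⟪L e₃, e₃⟫²) ≤ √2 · (|⟪L u₁, e₃⟫| + |⟪L u₂, e₃⟫| + |⟪L (u₂ − u₁), e₃⟫|)`.
Reading: `sin ∠(e₃, m) · √6 ≤` the density (per unit area of the disc normal to `e₃`) of in-plane
bond lines of the two grains crossing the cell. -/
theorem coaxial_sine_le_inPlaneClasses
    (L : EuclideanSpace ℝ (Fin 3) ≃ₗᵢ[ℝ] EuclideanSpace ℝ (Fin 3)) :
    Real.sqrt 6 * Real.sqrt (1 - ⟪L (EuclideanSpace.single (2 : Fin 3) (1 : ℝ)),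
        (EuclideanSpace.single (2 : Fin 3) (1 : ℝ))⟫_ℝ ^ 2) ≤
      Real.sqrt 2 * (|⟪L (triangularVec₁ 1), EuclideanSpace.single (2 : Fin 3) (1 : ℝ)⟫_ℝ| +
        |⟪L (triangularVec₂ 1), EuclideanSpace.single (2 : Fin 3) (1 : ℝ)⟫_ℝ| +
        |⟪L (triangularVec₂ 1 - triangularVec₁ 1), EuclideanSpace.single (2 : Fin 3) (1 : ℝ)⟫_ℝ|) := by
  set e₃ : EuclideanSpace ℝ (Fin 3) := EuclideanSpace.single (2 : Fin 3) (1 : ℝ) with he₃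
  set n : EuclideanSpace ℝ (Fin 3) := L.symm e₃ with hn
  have he₃L : e₃ = L n := by rw [hn, LinearIsometryEquiv.apply_symm_apply]
  have hflip : ∀ v : EuclideanSpace ℝ (Fin 3), ⟪L v, e₃⟫_ℝ = ⟪v, n⟫_ℝ := by
    intro v; rw [he₃L, LinearIsometryEquiv.inner_map_map]
  have hnorm : ‖n‖ = 1 := by
    rw [hn, LinearIsometryEquiv.norm_map, he₃, PiLp.norm_single, norm_one]
  rw [hflip, hflip, hflip, hflip, inner_sub_left]
  obtain ⟨h₁, h₂⟩ := inner_triangularVec n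
  rw [h₁, h₂]
  have he₃n : ⟪e₃, n⟫_ℝ = n 2 := by
    rw [he₃, EuclideanSpace.inner_single_left]; simp
  rw [he₃n, one_sub_sq_apply_two n hnorm]
  have hsub : n 0 / 2 + Real.sqrt 3 / 2 * n 1 - n 0 = -(n 0 / 2 - Real.sqrt 3 / 2 * n 1) := by ring
  rw [hsub, abs_neg]
  have h6 : Real.sqrt 6 = Real.sqrt 2 * Real.sqrt 3 := by
    rw [← Real.sqrt_mul (by norm_num)]; norm_num
  rw [h6, mul_assoc]
  exact mul_le_mul_of_nonneg_left (sqrt_three_mul_sqrt_le_hexNorm (n 0) (n 1))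
    (Real.sqrt_nonneg _)

/-- **Upper bound**: the in-plane line density is at most `2√2 · sin ∠(e₃, m)` (so it VANISHES for
the basal inclination — terraces break no in-plane line). -/
theorem inPlaneClasses_le_coaxial_sine
    (L : EuclideanSpace ℝ (Fin 3) ≃ₗᵢ[ℝ] EuclideanSpace ℝ (Fin 3)) :
    Real.sqrt 2 * (|⟪L (triangularVec₁ 1), EuclideanSpace.single (2 : Fin 3) (1 : ℝ)⟫_ℝ| +
        |⟪L (triangularVec₂ 1), EuclideanSpace.single (2 : Fin 3) (1 : ℝ)⟫_ℝ| +
        |⟪L (triangularVec₂ 1 - triangularVec₁ 1), EuclideanSpace.single (2 : Fin 3) (1 : ℝ)⟫_ℝ|) ≤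
      2 * Real.sqrt 2 * Real.sqrt (1 - ⟪L (EuclideanSpace.single (2 : Fin 3) (1 : ℝ)),
        (EuclideanSpace.single (2 : Fin 3) (1 : ℝ))⟫_ℝ ^ 2) := by
  set e₃ : EuclideanSpace ℝ (Fin 3) := EuclideanSpace.single (2 : Fin 3) (1 : ℝ) with he₃
  set n : EuclideanSpace ℝ (Fin 3) := L.symm e₃ with hn
  have he₃L : e₃ = L n := by rw [hn, LinearIsometryEquiv.apply_symm_apply]
  have hflip : ∀ v : EuclideanSpace ℝ (Fin 3), ⟪L v, e₃⟫_ℝ = ⟪v, n⟫_ℝ := by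
    intro v; rw [he₃L, LinearIsometryEquiv.inner_map_map]
  have hnorm : ‖n‖ = 1 := by
    rw [hn, LinearIsometryEquiv.norm_map, he₃, PiLp.norm_single, norm_one]
  rw [hflip, hflip, hflip, hflip, inner_sub_left]
  obtain ⟨h₁, h₂⟩ := inner_triangularVec n
  rw [h₁, h₂]
  have he₃n : ⟪e₃, n⟫_ℝ = n 2 := by
    rw [he₃, EuclideanSpace.inner_single_left]; simp
  rw [he₃n, one_sub_sq_apply_two n hnorm]
  have hsub : n 0 / 2 + Real.sqrt 3 / 2 * n 1 - n 0 = -(n 0 / 2 - Real.sqrt 3 / 2 * n 1) := by ring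
  rw [hsub, abs_neg]
  have h := hexNorm_le_two_mul_sqrt (n 0) (n 1)
  have h2 : 0 ≤ Real.sqrt 2 := Real.sqrt_nonneg _
  calc Real.sqrt 2 * (|n 0| + |n 0 / 2 + Real.sqrt 3 / 2 * n 1| + |n 0 / 2 - Real.sqrt 3 / 2 * n 1|)
      ≤ Real.sqrt 2 * (2 * Real.sqrt (n 0 ^ 2 + n 1 ^ 2)) := mul_le_mul_of_nonneg_left h h2
    _ = 2 * Real.sqrt 2 * Real.sqrt (n 0 ^ 2 + n 1 ^ 2) := by ring

end Summit.Ventures.Crystal3D.Theorems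

end
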